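import Mathlib.Analysis.SpecialFunctions.Integrals.Basic
import Mathlib.Analysis.SpecialFunctions.Integrability.Basic
import Mathlib.MeasureTheory.Integral.Prod
import Mathlib.MeasureTheory.Integral.Pi
import Mathlib.RingTheory.Algebraic.Integral
import Literature.NumberTheory.Transcendental.KZSemialgebraicComplex
import HarnessLib

/-!
# The Bloch–Wigner dilogarithm along a ray as a Kontsevich–Zagier integral representation

For real algebraic `p`, `q` and `z = p + iq` we define
`Literature.NumberTheory.Transcendental.KZ.rayDilogRep p q hp hq : KZ.IntegralRep 2`, the *ray
representation* `ρ(z)` of the Bloch–Wigner dilogarithm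
`D(z) = Im Li₂(z) + arg(1 − z) log|z|` [Zagier 2007, Ch. I §3; Brunault–Zudilin 2020, (4.3)]
requested by route `K2SymbolChains` (items `SteinbergChain`, `SmythCalibration`) of the summit
`KontsevichZagierPeriods`. Along the segment `w = sz`, `0 ≤ s ≤ 1`, the differential
`dD = log|w| d arg(1 − w) − log|1 − w| d arg(w)` [Brunault–Zudilin 2020, Exercise 4.4 (c)] reduces
to `log(s|z|) · (−q)/((1 − sp)² + (sq)²) ds` (`arg w` is constant on the ray), so
`D(z) = ∫₀¹ log(s|z|) (−q)/|1 − sz|² ds`; *unfolding the logarithm*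
(`log(s|z|) = ½ log V = ±∫ du/(2u)` over `u` between `1` and `V(s) = s²(p² + q²)`) gives the
two-dimensional representation with

* domain `rayDilogDomain p q = {(s, u) | 0 < s < 1, (1 < u < V(s)) ∨ (V(s) < u < 1)}`,
* integrand `rayDilogIntegrand p q (s, u) = sgn(u − 1) · (−q) / (2u((1 − sp)² + (sq)²))`,

literally the `ρa/ρb`-clauses of `SteinbergChain` (`rayDilogRep_domain`, `rayDilogRep_integrand`
are `rfl`).

## Main statements (all proved)

* `isSemialgebraic_rayDilogDomain`, `isSemialgebraicFunOn_rayDilogIntegrand`: `ℚ`-semialgebraicity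
  for algebraic `p`, `q` (the parameter `p² + q²` is a `ℚ`-definable constant,
  `isSemialgebraicFunOn_const_of_isAlgebraic`; graph elimination by Tarski–Seidenberg).
* `integrableOn_rayDilogIntegrand`: absolute integrability for *all* real `p`, `q` — for `q ≠ 0`,
  `|1 − sz|² ≥ q²/(p² + q²)` uniformly in `s` (`rayDilog_sq_le_mul_den`) and the integrand is
  dominated by a constant multiple of `s^{-1/2} u^{-3/4}` (`abs_rayDilogIntegrand_le`); for `q = 0`
  it vanishes.
* `rayDilogRep`, `rayDilogRep_domain`, `rayDilogRep_integrand`.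

* `rayDilog`, `rayDilogRep_value`: the value
  `(rayDilogRep p q hp hq).value = rayDilog p q = ∫₀¹ log(s|z|)(−q)/|1 − sz|² ds` (transport to
  `ℝ × ℝ`, Fubini, and the unfolded logarithm `setIntegral_rayDilogFibre`: `∫ du/(2u) = ½ log`);
  `rayDilog_zero_right` (`D|_ℝ = 0`), `rayDilog_neg_right` (`D(z̄) = −D(z)`).

## Design notes

* No side condition `(p, q) ≠ (0, 0)`, `¬(q = 0 ∧ 1 ≤ p)` (the segment avoiding `w = 1`) is
  imposed: none of the three obligations needs it, and for `q = 0` the representation is the zero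
  integrand on `(0,1) × (sheet)`, value `0 = D(p)`. The cone condition matters only for the Stokes
  argument of `SteinbergChain`, which carries it itself.
* Mathlib has no polylogarithm / Bloch–Wigner function (searched `polylog`, `dilog`, `BlochWigner`);
  the tree renders `D` geometrically (`idealTetrahedronVolume`, `ZagierDilogarithmConjecture.lean`)
  and, here, through Zagier's ray integral. The identification of the two renderings is not claimed.

## References

* D. Zagier, *The dilogarithm function*, in: Frontiers in Number Theory, Physics, and Geometry II,
  Springer (2007), Ch. I §3.
* F. Brunault, W. Zudilin, *Many Variations of Mahler Measures*, CUP (2020), §4.2, eq. (4.3),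
  Exercises 4.4–4.5.
* M. Kontsevich, D. Zagier, *Periods* (2001), §1.1 (algebraic coefficients are allowed).
-/

noncomputable section

open Set MvPolynomial
open _root_.MeasureTheory
open Literature.ModelTheory.ExponentialFields

namespace Literature.NumberTheory.Transcendental

namespace KZ

/-- The domain of the ray representation of `D(p + iq)`: coordinates `w = (s, u)`, `0 < s < 1`, and
`u` strictly between `1` and `V(s) = s² (p² + q²) = |s z|²` (on either side) — the logarithm
`log |sz| = ½ log V(s)` of Zagier's ray integral unfolded as `± ∫ du / (2u)`, as in
Kontsevich–Zagier's `log 2 = ∫_{1<x<2} dx/x`. [cite: KontsevichZagier2001, §1.1] -/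
def rayDilogDomain (p q : ℝ) : Set (Fin 2 → ℝ) :=
  {w | 0 < w 0 ∧ w 0 < 1 ∧ ((1 < w 1 ∧ w 1 < w 0 ^ 2 * (p ^ 2 + q ^ 2)) ∨
    (w 0 ^ 2 * (p ^ 2 + q ^ 2) < w 1 ∧ w 1 < 1))}

/-- The integrand of the ray representation of `D(p + iq)`:
`± (−q) / (2 u ((1 − s p)² + (s q)²))`, the sign being that of `u − 1` (the factor
`(−q)/((1 − sp)² + (sq)²) = d arg(1 − sz)/ds` of Zagier's ray integral times the unfolded
`± 1/(2u)`). [cite: KontsevichZagier2001, §1.1] -/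
def rayDilogIntegrand (p q : ℝ) (w : Fin 2 → ℝ) : ℝ :=
  (if 1 < w 1 then (1 : ℝ) else -1) * (-q) / (2 * w 1 * ((1 - w 0 * p) ^ 2 + (w 0 * q) ^ 2))

variable (p q : ℝ)

/-- Points of the ray domain have first coordinate in `(0, 1)`. [folklore] -/
theorem mem_Ioo_of_mem_rayDilogDomain {w : Fin 2 → ℝ} (hw : w ∈ rayDilogDomain p q) :
    w 0 ∈ Ioo (0 : ℝ) 1 :=
  ⟨hw.1, hw.2.1⟩

/-- Points of the ray domain have positive second coordinate. [folklore] -/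
theorem pos_of_mem_rayDilogDomain {w : Fin 2 → ℝ} (hw : w ∈ rayDilogDomain p q) : 0 < w 1 := by
  rcases hw.2.2 with h | h
  · exact zero_lt_one.trans h.1
  · exact lt_of_le_of_lt (by positivity) h.1

/-- The key lower bound `(p² + q²) · ((1 − s p)² + (s q)²) − q² = (p − s (p² + q²))² ≥ 0`:
`|1 − s z|² ≥ (Im z)² / |z|²` for every real `s`. [folklore] -/
theorem rayDilog_sq_le_mul_den (s : ℝ) :
    q ^ 2 ≤ (p ^ 2 + q ^ 2) * ((1 - s * p) ^ 2 + (s * q) ^ 2) := by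
  nlinarith [sq_nonneg (p - s * (p ^ 2 + q ^ 2))]

/-- For `q ≠ 0` the denominator `(1 − s p)² + (s q)²` is positive for every real `s`. [folklore] -/
theorem rayDilog_den_pos {q : ℝ} (hq : q ≠ 0) (p s : ℝ) : 0 < (1 - s * p) ^ 2 + (s * q) ^ 2 := by
  have hq2 : 0 < q ^ 2 := lt_of_le_of_ne (sq_nonneg q) (pow_ne_zero 2 hq).symm
  have hc : 0 < p ^ 2 + q ^ 2 := by positivity
  have h := rayDilog_sq_le_mul_den p q s
  rcases lt_or_ge 0 ((1 - s * p) ^ 2 + (s * q) ^ 2) with h' | h'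
  · exact h'
  · nlinarith

/-- The ray domain is `ℚ`-semialgebraic when `p`, `q` are real algebraic: the parameter
`p² + q²` is algebraic, hence a `ℚ`-definable constant, and the domain is a Boolean combination of
sign conditions on `ℚ̄`-polynomials. [cite: KontsevichZagier2001, §1.1] -/
theorem isSemialgebraic_rayDilogDomain (hp : IsAlgebraic ℚ p) (hq : IsAlgebraic ℚ q) :
    IsSemialgebraic ℚ (rayDilogDomain p q) := by
  have hc : IsAlgebraic ℚ (p ^ 2 + q ^ 2) := (hp.pow 2).add (hq.pow 2)
  have hu : IsSemialgebraic ℚ (univ : Set (Fin 2 → ℝ)) := isSemialgebraic_univ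
  have hV : IsSemialgebraicFunOn ℚ (univ : Set (Fin 2 → ℝ))
      (fun w => w 0 ^ 2 * (p ^ 2 + q ^ 2)) := by
    have h0 : IsSemialgebraicFunOn ℚ (univ : Set (Fin 2 → ℝ)) (fun w => w 0) := by
      simpa using isSemialgebraicFunOn_aeval hu (X 0 : MvPolynomial (Fin 2) ℚ)
    exact (IsSemialgebraicFunOn.mul_holds (IsSemialgebraicFunOn.mul_holds h0 h0)
      (isSemialgebraicFunOn_const_of_isAlgebraic hu hc)).congr fun w _ => by
        simp only [Pi.mul_apply]; ring
  have h1 : IsSemialgebraicFunOn ℚ (univ : Set (Fin 2 → ℝ)) (fun w => w 1) := by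
    simpa using isSemialgebraicFunOn_aeval hu (X 1 : MvPolynomial (Fin 2) ℚ)
  have hB : IsSemialgebraic ℚ {w : Fin 2 → ℝ | w 1 < w 0 ^ 2 * (p ^ 2 + q ^ 2)} := by
    convert (IsSemialgebraicFunOn.sub_holds h1 hV).isSemialgebraic_sep_neg using 1
    ext w
    simp [sub_neg]
  have hC : IsSemialgebraic ℚ {w : Fin 2 → ℝ | w 0 ^ 2 * (p ^ 2 + q ^ 2) < w 1} := by
    convert (IsSemialgebraicFunOn.sub_holds hV h1).isSemialgebraic_sep_neg using 1
    ext w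
    simp [sub_neg]
  have hA0 : IsSemialgebraic ℚ {w : Fin 2 → ℝ | 0 < w 0} := by
    simpa using isSemialgebraic_setOf_eval_pos (k := ℚ) (R := ℝ) (X 0 : MvPolynomial (Fin 2) ℚ)
  have hA1 : IsSemialgebraic ℚ {w : Fin 2 → ℝ | w 0 < 1} := by
    simpa using isSemialgebraic_setOf_eval_lt (k := ℚ) (R := ℝ) (X 0 : MvPolynomial (Fin 2) ℚ) 1
  have hP1 : IsSemialgebraic ℚ {w : Fin 2 → ℝ | 1 < w 1} := by
    simpa using isSemialgebraic_setOf_eval_lt (k := ℚ) (R := ℝ) 1 (X 1 : MvPolynomial (Fin 2) ℚ)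
  have hP2 : IsSemialgebraic ℚ {w : Fin 2 → ℝ | w 1 < 1} := by
    simpa using isSemialgebraic_setOf_eval_lt (k := ℚ) (R := ℝ) (X 1 : MvPolynomial (Fin 2) ℚ) 1
  convert (hA0.inter hA1).inter ((hP1.inter hB).union (hC.inter hP2)) using 1
  ext w
  simp only [rayDilogDomain, mem_setOf_eq, mem_inter_iff, mem_union]
  tauto

/-- The sign factor `sgn(u − 1)` is a `ℚ`-semialgebraic function on `ℝ²`. [folklore] -/
theorem isSemialgebraicFunOn_rayDilogSign :
    IsSemialgebraicFunOn ℚ (univ : Set (Fin 2 → ℝ)) (fun w => if 1 < w 1 then (1 : ℝ) else -1) := by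
  have hP1 : IsSemialgebraic ℚ {w : Fin 2 → ℝ | 1 < w 1} := by
    simpa using isSemialgebraic_setOf_eval_lt (k := ℚ) (R := ℝ) 1 (X 1 : MvPolynomial (Fin 2) ℚ)
  have hf : IsSemialgebraicFunOn ℚ {w : Fin 2 → ℝ | 1 < w 1} (fun _ => (1 : ℝ)) := by
    simpa using isSemialgebraicFunOn_natCast hP1 1
  have hg : IsSemialgebraicFunOn ℚ {w : Fin 2 → ℝ | 1 < w 1}ᶜ (fun _ => (-1 : ℝ)) :=
    (isSemialgebraicFunOn_natCast hP1.compl 1).neg.congr fun w _ => by simp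
  have h := IsSemialgebraicFunOn.union hf hg (F := fun w => if 1 < w 1 then (1 : ℝ) else -1)
    (fun w hw => by simp only [mem_setOf_eq] at hw; simp [hw])
    (fun w hw => by simp only [mem_compl_iff, mem_setOf_eq] at hw; simp [hw])
  rwa [union_compl_self] at h

/-- The integrand of the ray representation is a `ℚ`-semialgebraic function on the ray domain when
`p`, `q` are real algebraic (sign factor glued from two constants; a quotient of `ℚ̄`-polynomials
with non-vanishing denominator; identically `0` when `q = 0`). [cite: KontsevichZagier2001, §1.1] -/
theorem isSemialgebraicFunOn_rayDilogIntegrand (hp : IsAlgebraic ℚ p) (hq : IsAlgebraic ℚ q) :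
    IsSemialgebraicFunOn ℚ (rayDilogDomain p q) (rayDilogIntegrand p q) := by
  have hD := isSemialgebraic_rayDilogDomain p q hp hq
  by_cases hq0 : q = 0
  · refine (isSemialgebraicFunOn_natCast hD 0).congr fun w _ => ?_
    simp [rayDilogIntegrand, hq0]
  have hu : IsSemialgebraic ℚ (univ : Set (Fin 2 → ℝ)) := isSemialgebraic_univ
  have h0 : IsSemialgebraicFunOn ℚ (univ : Set (Fin 2 → ℝ)) (fun w => w 0) := by
    simpa using isSemialgebraicFunOn_aeval hu (X 0 : MvPolynomial (Fin 2) ℚ)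
  have h1 : IsSemialgebraicFunOn ℚ (univ : Set (Fin 2 → ℝ)) (fun w => w 1) := by
    simpa using isSemialgebraicFunOn_aeval hu (X 1 : MvPolynomial (Fin 2) ℚ)
  have hpC := isSemialgebraicFunOn_const_of_isAlgebraic hu hp
  have hqC := isSemialgebraicFunOn_const_of_isAlgebraic hu hq
  have hden : IsSemialgebraicFunOn ℚ (univ : Set (Fin 2 → ℝ))
      (fun w => 2 * w 1 * ((1 - w 0 * p) ^ 2 + (w 0 * q) ^ 2)) := by
    have e1 := IsSemialgebraicFunOn.sub_holds (isSemialgebraicFunOn_natCast hu 1)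
      (IsSemialgebraicFunOn.mul_holds h0 hpC)
    have e2 := IsSemialgebraicFunOn.mul_holds h0 hqC
    have h := IsSemialgebraicFunOn.mul_holds
      (IsSemialgebraicFunOn.mul_holds (isSemialgebraicFunOn_natCast hu 2) h1)
      (IsSemialgebraicFunOn.add_holds (IsSemialgebraicFunOn.mul_holds e1 e1)
        (IsSemialgebraicFunOn.mul_holds e2 e2))
    refine h.congr fun w _ => ?_
    simp only [Pi.mul_apply, Pi.add_apply, Pi.sub_apply, Nat.cast_ofNat, Nat.cast_one]
    ring
  have hden0 : ∀ w ∈ rayDilogDomain p q, 2 * w 1 * ((1 - w 0 * p) ^ 2 + (w 0 * q) ^ 2) ≠ 0 :=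
    fun w hw => (mul_pos (mul_pos two_pos (pos_of_mem_rayDilogDomain p q hw))
      (rayDilog_den_pos hq0 p (w 0))).ne'
  have h := IsSemialgebraicFunOn.mul_holds
    ((isSemialgebraicFunOn_rayDilogSign).mono (subset_univ _) hD)
    ((hqC.neg.mono (subset_univ _) hD).div (hden.mono (subset_univ _) hD) hden0)
  refine h.congr fun w _ => ?_
  simp only [rayDilogIntegrand, Pi.mul_apply, Pi.neg_apply]
  ring

/-- The integrand of the ray representation is Borel measurable on `ℝ²`. [folklore] -/
theorem measurable_rayDilogIntegrand : Measurable (rayDilogIntegrand p q) := by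
  unfold rayDilogIntegrand
  refine Measurable.div (Measurable.mul ?_ measurable_const) ?_
  · exact Measurable.ite (measurableSet_lt measurable_const (measurable_pi_apply 1))
      measurable_const measurable_const
  · fun_prop

/-- The ray domain is a Borel set. [folklore] -/
theorem measurableSet_rayDilogDomain : MeasurableSet (rayDilogDomain p q) := by
  have hV : Measurable fun w : Fin 2 → ℝ => w 0 ^ 2 * (p ^ 2 + q ^ 2) := by fun_prop
  have e0 : Measurable fun w : Fin 2 → ℝ => w 0 := measurable_pi_apply 0
  have e1 : Measurable fun w : Fin 2 → ℝ => w 1 := measurable_pi_apply 1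
  simp only [rayDilogDomain, setOf_and, setOf_or]
  exact (measurableSet_lt measurable_const e0).inter ((measurableSet_lt e0 measurable_const).inter
    (((measurableSet_lt measurable_const e1).inter (measurableSet_lt e1 hV)).union
      ((measurableSet_lt hV e1).inter (measurableSet_lt e1 measurable_const))))

/-! ### Absolute integrability -/

/-- **Pointwise domination** (case `q ≠ 0`). On the ray domain, with `c = p² + q²`,
`|f(s, u)| ≤ (c / (2|q|)) · max(c^{3/4}, c^{-1/4}) · s^{-1/2} · u^{-3/4}`: indeed
`|f| = |q| / (2u|1 − sz|²) ≤ c / (2|q|u)` by `rayDilog_sq_le_mul_den`, and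
`1/u ≤ c^{3/4} s^{-1/2} u^{-3/4}` on the sheet `1 < u < s²c ≤ c`,
`1/u = u^{-1/4} u^{-3/4} ≤ (s²c)^{-1/4} u^{-3/4}` on the sheet `s²c < u < 1`.
The dominating function is a product of one-variable integrable powers. [folklore] -/
theorem abs_rayDilogIntegrand_le {q : ℝ} (hq : q ≠ 0) (p : ℝ) {w : Fin 2 → ℝ}
    (hw : w ∈ rayDilogDomain p q) :
    |rayDilogIntegrand p q w| ≤
      (p ^ 2 + q ^ 2) / (2 * |q|) *
        max ((p ^ 2 + q ^ 2) ^ (3 / 4 : ℝ)) ((p ^ 2 + q ^ 2) ^ (-(1 / 4) : ℝ)) *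
        (w 0 ^ (-(1 / 2) : ℝ) * w 1 ^ (-(3 / 4) : ℝ)) := by
  have hc : 0 < p ^ 2 + q ^ 2 := by positivity
  have hs : 0 < w 0 ∧ w 0 < 1 := ⟨hw.1, hw.2.1⟩
  have hu : 0 < w 1 := pos_of_mem_rayDilogDomain p q hw
  have hd : 0 < (1 - w 0 * p) ^ 2 + (w 0 * q) ^ 2 := rayDilog_den_pos hq p (w 0)
  have hqabs : 0 < |q| := abs_pos.mpr hq
  -- `|f| = |q| / (2 u d)`
  have habs : |rayDilogIntegrand p q w| =
      |q| / (2 * w 1 * ((1 - w 0 * p) ^ 2 + (w 0 * q) ^ 2)) := by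
    have hsgn : |(if 1 < w 1 then (1 : ℝ) else -1)| = 1 := by split_ifs <;> simp
    rw [rayDilogIntegrand, abs_div, abs_mul, hsgn, one_mul, abs_neg,
      abs_of_pos (by positivity : 0 < 2 * w 1 * ((1 - w 0 * p) ^ 2 + (w 0 * q) ^ 2))]
  -- step 1: `|f| ≤ c / (2|q|) · u⁻¹`
  have h1 : |rayDilogIntegrand p q w| ≤ (p ^ 2 + q ^ 2) / (2 * |q|) * (w 1)⁻¹ := by
    rw [habs, div_le_iff₀ (by positivity)]
    have key : q ^ 2 ≤ (p ^ 2 + q ^ 2) * ((1 - w 0 * p) ^ 2 + (w 0 * q) ^ 2) :=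
      rayDilog_sq_le_mul_den p q (w 0)
    have hu0 : w 1 ≠ 0 := hu.ne'
    have hq0 : |q| ≠ 0 := hqabs.ne'
    calc |q| = q ^ 2 / |q| := by rw [← sq_abs, sq, mul_self_div_self]
      _ ≤ (p ^ 2 + q ^ 2) * ((1 - w 0 * p) ^ 2 + (w 0 * q) ^ 2) / |q| :=
          div_le_div_of_nonneg_right key hqabs.le
      _ = (p ^ 2 + q ^ 2) / (2 * |q|) * (w 1)⁻¹ *
            (2 * w 1 * ((1 - w 0 * p) ^ 2 + (w 0 * q) ^ 2)) := by
          field_simp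
  -- step 2: `u⁻¹ ≤ M · s^{-1/2} · u^{-3/4}`
  have h2 : (w 1)⁻¹ ≤ max ((p ^ 2 + q ^ 2) ^ (3 / 4 : ℝ)) ((p ^ 2 + q ^ 2) ^ (-(1 / 4) : ℝ)) *
      (w 0 ^ (-(1 / 2) : ℝ) * w 1 ^ (-(3 / 4) : ℝ)) := by
    have hs_rpow : 1 ≤ w 0 ^ (-(1 / 2) : ℝ) :=
      Real.one_le_rpow_of_pos_of_le_one_of_nonpos hs.1 hs.2.le (by norm_num)
    rcases hw.2.2 with ⟨hu1, huV⟩ | ⟨hVu, hu1⟩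
    · -- the sheet `1 < u < s² c ≤ c`
      have hs2 : w 0 ^ 2 ≤ 1 := by nlinarith [hs.1, hs.2]
      have huc : w 1 ≤ p ^ 2 + q ^ 2 := by nlinarith
      have hu_rpow : (p ^ 2 + q ^ 2) ^ (-(3 / 4) : ℝ) ≤ w 1 ^ (-(3 / 4) : ℝ) :=
        Real.rpow_le_rpow_of_nonpos hu huc (by norm_num)
      calc (w 1)⁻¹ ≤ 1 := inv_le_one_of_one_le₀ hu1.le
        _ = (p ^ 2 + q ^ 2) ^ (3 / 4 : ℝ) * (1 * (p ^ 2 + q ^ 2) ^ (-(3 / 4) : ℝ)) := by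
            rw [one_mul, ← Real.rpow_add hc]
            norm_num
        _ ≤ _ := by
            apply mul_le_mul (le_max_left _ _) _ (by positivity) (by positivity)
            exact mul_le_mul hs_rpow hu_rpow (by positivity) (by positivity)
    · -- the sheet `s² c < u < 1`
      have hV : 0 < w 0 ^ 2 * (p ^ 2 + q ^ 2) := mul_pos (pow_pos hs.1 2) hc
      calc (w 1)⁻¹ = w 1 ^ (-(1 / 4) : ℝ) * w 1 ^ (-(3 / 4) : ℝ) := by
            rw [← Real.rpow_add hu, ← Real.rpow_neg_one]
            norm_num
        _ ≤ (w 0 ^ 2 * (p ^ 2 + q ^ 2)) ^ (-(1 / 4) : ℝ) * w 1 ^ (-(3 / 4) : ℝ) := by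
            apply mul_le_mul_of_nonneg_right _ (Real.rpow_nonneg hu.le _)
            exact Real.rpow_le_rpow_of_nonpos hV hVu.le (by norm_num)
        _ = (p ^ 2 + q ^ 2) ^ (-(1 / 4) : ℝ) * (w 0 ^ (-(1 / 2) : ℝ) * w 1 ^ (-(3 / 4) : ℝ)) := by
            rw [Real.mul_rpow (by positivity) hc.le, ← Real.rpow_natCast (w 0) 2,
              ← Real.rpow_mul hs.1.le]
            have h24 : ((2 : ℕ) : ℝ) * (-(1 / 4) : ℝ) = -(1 / 2) := by norm_num
            rw [h24]
            ring
        _ ≤ _ := mul_le_mul_of_nonneg_right (le_max_right _ _) (by positivity)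
  calc |rayDilogIntegrand p q w| ≤ (p ^ 2 + q ^ 2) / (2 * |q|) * (w 1)⁻¹ := h1
    _ ≤ (p ^ 2 + q ^ 2) / (2 * |q|) * (max ((p ^ 2 + q ^ 2) ^ (3 / 4 : ℝ))
          ((p ^ 2 + q ^ 2) ^ (-(1 / 4) : ℝ)) * (w 0 ^ (-(1 / 2) : ℝ) * w 1 ^ (-(3 / 4) : ℝ))) :=
        mul_le_mul_of_nonneg_left h2 (by positivity)
    _ = _ := by ring

/-- On the ray domain the second coordinate is below `max 1 (p² + q²)`. [folklore] -/
theorem lt_max_of_mem_rayDilogDomain {w : Fin 2 → ℝ} (hw : w ∈ rayDilogDomain p q) :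
    w 1 < max 1 (p ^ 2 + q ^ 2) := by
  rcases hw.2.2 with ⟨_, huV⟩ | ⟨_, hu1⟩
  · refine lt_of_lt_of_le (huV.trans_le ?_) (le_max_right _ _)
    have hs2 : w 0 ^ 2 ≤ 1 := by nlinarith [hw.1, hw.2.1]
    nlinarith [add_nonneg (sq_nonneg p) (sq_nonneg q)]
  · exact hu1.trans_le (le_max_left _ _)

/-- **Absolute integrability of the ray representation.** The integrand is absolutely integrable
on the ray domain: for `q = 0` it vanishes identically; for `q ≠ 0` it is dominated
(`abs_rayDilogIntegrand_le`) by a constant multiple of `s^{-1/2} · u^{-3/4}` on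
`(0,1) × (0, max 1 c)`, a product of integrable powers (`Integrable.fintype_prod`). Equivalently:
the logarithmic singularity `log(s|z|)` at the apex `s → 0` of the cone is integrable and `|1 − sz|`
is bounded below along the segment. [cite: Zagier2007Dilogarithm, Ch. I §3] -/
theorem integrableOn_rayDilogIntegrand :
    IntegrableOn (rayDilogIntegrand p q) (rayDilogDomain p q) := by
  by_cases hq : q = 0
  · have h0 : rayDilogIntegrand p q = fun _ => 0 := by
      funext w
      simp [rayDilogIntegrand, hq]
    rw [h0]
    exact integrableOn_zero
  -- the dominating product function
  set K : ℝ := (p ^ 2 + q ^ 2) / (2 * |q|) *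
    max ((p ^ 2 + q ^ 2) ^ (3 / 4 : ℝ)) ((p ^ 2 + q ^ 2) ^ (-(1 / 4) : ℝ)) with hK
  set φ : ℝ → ℝ := (Ioo (0 : ℝ) 1).indicator fun s => s ^ (-(1 / 2) : ℝ) with hφ_def
  set ψ : ℝ → ℝ := (Ioo (0 : ℝ) (max 1 (p ^ 2 + q ^ 2))).indicator fun u => u ^ (-(3 / 4) : ℝ)
    with hψ_def
  have hφ : Integrable φ := by
    refine (integrable_indicator_iff measurableSet_Ioo).mpr ?_
    exact ((intervalIntegral.intervalIntegrable_rpow' (a := 0) (b := 1) (by norm_num)).1).mono_set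
      Ioo_subset_Ioc_self
  have hψ : Integrable ψ := by
    refine (integrable_indicator_iff measurableSet_Ioo).mpr ?_
    exact ((intervalIntegral.intervalIntegrable_rpow' (a := 0) (b := max 1 (p ^ 2 + q ^ 2))
      (by norm_num)).1).mono_set Ioo_subset_Ioc_self
  have hg : Integrable (fun w : Fin 2 → ℝ => K * (φ (w 0) * ψ (w 1))) := by
    have h := Integrable.fintype_prod (ι := Fin 2) (f := ![φ, ψ])
      (μ := fun _ => (volume : Measure ℝ))
      (Fin.forall_fin_two.mpr ⟨by simpa using hφ, by simpa using hψ⟩)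
    have h' : Integrable (fun w : Fin 2 → ℝ => φ (w 0) * ψ (w 1)) := by
      refine h.congr (Filter.Eventually.of_forall fun w => ?_)
      simp [Fin.prod_univ_two]
    exact h'.const_mul K
  refine Integrable.mono' hg.integrableOn (measurable_rayDilogIntegrand p q).aestronglyMeasurable ?_
  refine ae_restrict_of_forall_mem (measurableSet_rayDilogDomain p q) fun w hw => ?_
  rw [Real.norm_eq_abs]
  have hφw : φ (w 0) = w 0 ^ (-(1 / 2) : ℝ) :=
    indicator_of_mem (mem_Ioo_of_mem_rayDilogDomain p q hw) _
  have hmem1 : w 1 ∈ Ioo (0 : ℝ) (max 1 (p ^ 2 + q ^ 2)) :=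
    ⟨pos_of_mem_rayDilogDomain p q hw, lt_max_of_mem_rayDilogDomain p q hw⟩
  have hψw : ψ (w 1) = w 1 ^ (-(3 / 4) : ℝ) := indicator_of_mem hmem1 _
  rw [hφw, hψw]
  exact abs_rayDilogIntegrand_le hq p hw

/-! ### The representation and its value integral -/

/-- **The Bloch–Wigner dilogarithm along the ray as a KZ integral representation.** For real
algebraic `p`, `q` and `z = p + iq`, the two-dimensional Kontsevich–Zagier representation obtained
by *unfolding the logarithm* in Zagier's ray integral `D(z) = ∫₀¹ log(s|z|) (−q)/|1 − sz|² ds`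
(`log(s|z|) = ½ log V(s) = ± ∫ du/(2u)` over `u` between `1` and `V(s) = s²(p² + q²)`):
coordinates `w = (s, u)`, domain `{0 < s < 1, (1 < u < V(s)) ∨ (V(s) < u < 1)}`, integrand
`sgn(u − 1) · (−q) / (2u ((1 − sp)² + (sq)²))`. It is the ray representation `ρ(z)` of route
`K2SymbolChains` (items `SteinbergChain`, `SmythCalibration`), whose domain/integrand clauses it
matches literally (`rayDilogRep_domain`, `rayDilogRep_integrand`). No side condition on `(p, q)` is
needed for the three obligations: `ℚ`-semialgebraicity uses only that `p`, `q` (hence `p² + q²`)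
are algebraic, and absolute integrability holds for all real `p`, `q`
(`integrableOn_rayDilogIntegrand`); the value is `rayDilog p q` (`rayDilogRep_value`).
[cite: Zagier2007Dilogarithm, Ch. I §3] -/
def rayDilogRep (p q : ℝ) (hp : IsAlgebraic ℚ p) (hq : IsAlgebraic ℚ q) : IntegralRep 2 where
  domain := rayDilogDomain p q
  integrand := rayDilogIntegrand p q
  isSemialgebraic_domain := isSemialgebraic_rayDilogDomain p q hp hq
  isSemialgebraicFunOn_integrand := isSemialgebraicFunOn_rayDilogIntegrand p q hp hq
  integrableOn := integrableOn_rayDilogIntegrand p q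

/-- The domain of the ray representation, literally as in the `ρ`-clauses of route
`K2SymbolChains`. [cite: Zagier2007Dilogarithm, Ch. I §3] -/
@[simp] theorem rayDilogRep_domain (hp : IsAlgebraic ℚ p) (hq : IsAlgebraic ℚ q) :
    (rayDilogRep p q hp hq).domain =
      {w | 0 < w 0 ∧ w 0 < 1 ∧ ((1 < w 1 ∧ w 1 < w 0 ^ 2 * (p ^ 2 + q ^ 2)) ∨
        (w 0 ^ 2 * (p ^ 2 + q ^ 2) < w 1 ∧ w 1 < 1))} :=
  rfl

/-- The integrand of the ray representation, literally as in the `ρ`-clauses of route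
`K2SymbolChains`. [cite: Zagier2007Dilogarithm, Ch. I §3] -/
@[simp] theorem rayDilogRep_integrand (hp : IsAlgebraic ℚ p) (hq : IsAlgebraic ℚ q)
    (w : Fin 2 → ℝ) :
    (rayDilogRep p q hp hq).integrand w =
      (if 1 < w 1 then (1 : ℝ) else -1) * (-q) / (2 * w 1 * ((1 - w 0 * p) ^ 2 + (w 0 * q) ^ 2)) :=
  rfl

/-- The value of the ray representation is `∫_{domain} integrand`. [folklore] -/
theorem rayDilogRep_value_eq_setIntegral (hp : IsAlgebraic ℚ p) (hq : IsAlgebraic ℚ q) :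
    (rayDilogRep p q hp hq).value = ∫ w in rayDilogDomain p q, rayDilogIntegrand p q w :=
  rfl

/-! ### The value: Fubini and `∫ du/u = log` -/

/-- **Zagier's ray integral for the Bloch–Wigner dilogarithm.** For `z = p + iq`,
`rayDilog p q = ∫₀¹ log(s |z|) · (−q) / ((1 − s p)² + (s q)²) ds`.
This is `D(z)`, the Bloch–Wigner dilogarithm `D(z) = Im Li₂(z) + arg(1 − z) log|z|`
[Zagier 2007, Ch. I §3; Brunault–Zudilin 2020, eq. (4.3)], integrated along the segment `w = s z`,
`0 ≤ s ≤ 1`: by `dD = log|w| d arg(1 − w) − log|1 − w| d arg(w)` [Brunault–Zudilin 2020,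
Exercise 4.4 (c); Zagier 2007, Ch. I §3] and `d arg(w) = 0`, `d arg(1 − s z)/ds = −q / |1 − s z|²`
along the ray, `D(z) − D(0) = ∫₀¹ log(s|z|) (−q)/|1 − sz|² ds` with `D(0) = 0`, whenever the segment
avoids `w = 1` (i.e. not `q = 0 ∧ 1 ≤ p`); for real `z` both sides vanish. Mathlib has no
polylogarithm, so the tree records `D` through this absolutely convergent real integral (numerics
of the planner of route `K2SymbolChains`: `D(e^{iπ/3}) = 1.0149416 = Cl₂(π/3)`).
[cite: Zagier2007Dilogarithm, Ch. I §3] -/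
def rayDilog (p q : ℝ) : ℝ :=
  ∫ s in (0 : ℝ)..1, Real.log (s * √(p ^ 2 + q ^ 2)) * (-q / ((1 - s * p) ^ 2 + (s * q) ^ 2))

/-- Unfolding lemma for `rayDilog`. [cite: Zagier2007Dilogarithm, Ch. I §3] -/
theorem rayDilog_def (p q : ℝ) : rayDilog p q =
    ∫ s in (0 : ℝ)..1, Real.log (s * √(p ^ 2 + q ^ 2)) * (-q / ((1 - s * p) ^ 2 + (s * q) ^ 2)) :=
  rfl

/-- `D` vanishes on the real axis: `rayDilog p 0 = 0` (the integrand carries the factor `−q`).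
[cite: Zagier2007Dilogarithm, Ch. I §3] -/
@[simp] theorem rayDilog_zero_right (p : ℝ) : rayDilog p 0 = 0 := by
  simp [rayDilog]

/-- `D(z̄) = −D(z)`: `rayDilog p (−q) = −rayDilog p q` (the integrand is odd in `q`).
[cite: Zagier2007Dilogarithm, Ch. I §3] -/
theorem rayDilog_neg_right (p q : ℝ) : rayDilog p (-q) = -rayDilog p q := by
  rw [rayDilog, rayDilog, ← intervalIntegral.integral_neg]
  congr 1
  funext s
  rw [mul_neg, neg_sq, neg_sq]
  ring

/-- **The unfolded logarithm, one fibre.** For `V > 0` and any constant `K`,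
`∫_{u ∈ (1,V) ∪ (V,1)} sgn(u − 1) · K / (2u) du = (K/2) · log V` (`= ∫₁^V K du/(2u)` read with
orientation). [cite: KontsevichZagier2001, §1.1] -/
theorem setIntegral_rayDilogFibre {V : ℝ} (hV : 0 < V) (K : ℝ) :
    ∫ u in {u : ℝ | (1 < u ∧ u < V) ∨ (V < u ∧ u < 1)},
      (if 1 < u then (1 : ℝ) else -1) * K / (2 * u) = K / 2 * Real.log V := by
  rcases le_or_gt 1 V with h1V | hV1
  · have hset : {u : ℝ | (1 < u ∧ u < V) ∨ (V < u ∧ u < 1)} = Ioo 1 V := by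
      ext u
      simp only [mem_setOf_eq, mem_Ioo]
      constructor
      · rintro (h | h)
        · exact h
        · exact absurd (h.1.trans h.2) (not_lt.mpr h1V)
      · exact fun h => Or.inl h
    rw [hset, setIntegral_congr_fun measurableSet_Ioo (g := fun u => K / 2 * u⁻¹)
      (fun u hu => by rw [if_pos hu.1]; ring)]
    rw [integral_const_mul, ← integral_Ioc_eq_integral_Ioo,
      ← intervalIntegral.integral_of_le h1V, integral_inv_of_pos one_pos (one_pos.trans_le h1V),
      div_one]
  · have hset : {u : ℝ | (1 < u ∧ u < V) ∨ (V < u ∧ u < 1)} = Ioo V 1 := by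
      ext u
      simp only [mem_setOf_eq, mem_Ioo]
      constructor
      · rintro (h | h)
        · exact absurd (h.1.trans (h.2.trans hV1)) (lt_irrefl _)
        · exact h
      · exact fun h => Or.inr h
    rw [hset, setIntegral_congr_fun measurableSet_Ioo (g := fun u => -(K / 2) * u⁻¹)
      (fun u hu => by rw [if_neg (not_lt.mpr hu.2.le)]; ring)]
    rw [integral_const_mul, ← integral_Ioc_eq_integral_Ioo,
      ← intervalIntegral.integral_of_le hV1.le, integral_inv_of_pos hV one_pos, one_div,
      Real.log_inv]
    ring

/-- The fibre `{u | (1 < u < V) ∨ (V < u < 1)}` is a Borel set. [folklore] -/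
theorem measurableSet_rayDilogFibre (V : ℝ) :
    MeasurableSet {u : ℝ | (1 < u ∧ u < V) ∨ (V < u ∧ u < 1)} := by
  simp only [setOf_or, setOf_and]
  exact (measurableSet_Ioi.inter measurableSet_Iio).union
    (measurableSet_Ioi.inter measurableSet_Iio)

/-- **Value of the ray representation**: `(rayDilogRep p q hp hq).value = rayDilog p q`, i.e.
`∫∫_{domain} sgn(u−1)(−q)/(2u|1 − sz|²) du ds = ∫₀¹ log(s|z|)(−q)/|1 − sz|² ds (= D(z))`.
Proof: transport `ℝ² ≃ᵐ ℝ × ℝ` (`MeasurableEquiv.finTwoArrow`), Fubini (`integral_prod`, the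
integrand being absolutely integrable by `integrableOn_rayDilogIntegrand`), and on each fibre
`s ∈ (0,1)` the unfolded logarithm `setIntegral_rayDilogFibre` with `V = s²(p² + q²)`,
`½ log V = log(s √(p² + q²))`; for `q = 0` both sides vanish.
[cite: Zagier2007Dilogarithm, Ch. I §3] -/
theorem rayDilogRep_value (hp : IsAlgebraic ℚ p) (hq : IsAlgebraic ℚ q) :
    (rayDilogRep p q hp hq).value = rayDilog p q := by
  rw [rayDilogRep_value_eq_setIntegral]
  by_cases hq0 : q = 0
  · subst hq0
    simp [rayDilogIntegrand, rayDilog]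
  have hc : 0 < p ^ 2 + q ^ 2 := by positivity
  have hDm := measurableSet_rayDilogDomain p q
  -- transport to `ℝ × ℝ`
  set e : (Fin 2 → ℝ) ≃ᵐ ℝ × ℝ := MeasurableEquiv.finTwoArrow with he_def
  have he : MeasurePreserving e volume volume := volume_preserving_finTwoArrow ℝ
  have he0 : ∀ x : ℝ × ℝ, e.symm x 0 = x.1 := fun _ => rfl
  have he1 : ∀ x : ℝ × ℝ, e.symm x 1 = x.2 := fun _ => rfl
  set G : (Fin 2 → ℝ) → ℝ := (rayDilogDomain p q).indicator (rayDilogIntegrand p q) with hG_def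
  have hG : Integrable G := (integrable_indicator_iff hDm).mpr (integrableOn_rayDilogIntegrand p q)
  have hG2 : Integrable (fun x : ℝ × ℝ => G (e.symm x))
      ((volume : Measure ℝ).prod (volume : Measure ℝ)) := by
    have h := ((he.symm e).integrable_comp_emb e.symm.measurableEmbedding (g := G)).mpr hG
    rw [← Measure.volume_eq_prod]
    exact h
  -- the fibre integrals
  have hfib : ∀ s : ℝ, ∫ u, G (e.symm (s, u)) = (Ioo (0 : ℝ) 1).indicator
      (fun s => Real.log (s * √(p ^ 2 + q ^ 2)) * (-q / ((1 - s * p) ^ 2 + (s * q) ^ 2))) s := by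
    intro s
    by_cases hs : s ∈ Ioo (0 : ℝ) 1
    · rw [indicator_of_mem hs]
      have hfun : (fun u => G (e.symm (s, u))) =
          {u : ℝ | (1 < u ∧ u < s ^ 2 * (p ^ 2 + q ^ 2)) ∨
              (s ^ 2 * (p ^ 2 + q ^ 2) < u ∧ u < 1)}.indicator
            (fun u => (if 1 < u then (1 : ℝ) else -1) *
              (-q / ((1 - s * p) ^ 2 + (s * q) ^ 2)) / (2 * u)) := by
        funext u
        by_cases hC : u ∈ ({u : ℝ | (1 < u ∧ u < s ^ 2 * (p ^ 2 + q ^ 2)) ∨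
            (s ^ 2 * (p ^ 2 + q ^ 2) < u ∧ u < 1)} : Set ℝ)
        · have hmem : e.symm (s, u) ∈ rayDilogDomain p q := by
            simp only [rayDilogDomain, mem_setOf_eq, he0, he1]
            exact ⟨hs.1, hs.2, hC⟩
          rw [hG_def, indicator_of_mem hmem, indicator_of_mem hC]
          simp only [rayDilogIntegrand, he0, he1]
          rw [mul_div_assoc, mul_div_assoc, div_div,
            mul_comm ((1 - s * p) ^ 2 + (s * q) ^ 2) (2 * u)]
        · have hnmem : e.symm (s, u) ∉ rayDilogDomain p q := fun h => hC (by
            simp only [rayDilogDomain, mem_setOf_eq, he0, he1] at h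
            exact h.2.2)
          rw [hG_def, indicator_of_notMem hnmem, indicator_of_notMem hC]
      have hV : 0 < s ^ 2 * (p ^ 2 + q ^ 2) := mul_pos (pow_pos hs.1 2) hc
      rw [hfun, integral_indicator (measurableSet_rayDilogFibre _), setIntegral_rayDilogFibre hV]
      have hsq : s ^ 2 * (p ^ 2 + q ^ 2) = (s * √(p ^ 2 + q ^ 2)) ^ 2 := by
        rw [mul_pow, Real.sq_sqrt hc.le]
      rw [hsq, Real.log_pow]
      push_cast
      ring
    · rw [indicator_of_notMem hs]
      have hzero : (fun u => G (e.symm (s, u))) = fun _ => 0 := by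
        funext u
        refine indicator_of_notMem (fun h => hs ?_) _
        simp only [rayDilogDomain, mem_setOf_eq, he0, he1] at h
        exact ⟨h.1, h.2.1⟩
      rw [hzero, integral_zero]
  calc ∫ w in rayDilogDomain p q, rayDilogIntegrand p q w
      = ∫ w, G w := (integral_indicator hDm).symm
    _ = ∫ x, G (e.symm x) := ((he.symm e).integral_comp' G).symm
    _ = ∫ x : ℝ × ℝ, G (e.symm x) ∂((volume : Measure ℝ).prod (volume : Measure ℝ)) := by
        rw [Measure.volume_eq_prod]
    _ = ∫ s, ∫ u, G (e.symm (s, u)) := integral_prod _ hG2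
    _ = ∫ s, (Ioo (0 : ℝ) 1).indicator (fun s =>
          Real.log (s * √(p ^ 2 + q ^ 2)) * (-q / ((1 - s * p) ^ 2 + (s * q) ^ 2))) s := by
        congr 1
        funext s
        exact hfib s
    _ = ∫ s in Ioo (0 : ℝ) 1,
          Real.log (s * √(p ^ 2 + q ^ 2)) * (-q / ((1 - s * p) ^ 2 + (s * q) ^ 2)) :=
        integral_indicator measurableSet_Ioo
    _ = rayDilog p q := by
        rw [rayDilog, intervalIntegral.integral_of_le zero_le_one, integral_Ioc_eq_integral_Ioo]

end KZ

end Literature.NumberTheory.Transcendental
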